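import Literature.NumberTheory.GaloisRepresentations.AbsGaloisGroup
import HarnessLib

/-!
# Conjugation of `Gal(K̄/K)` by a semilinear automorphism of `K̄`

Let `K` be a field, `K̄ = AlgebraicClosure K`, `γ : K ≃+* K` and `σ̃ : K̄ ≃+* K̄` an automorphism EXTENDING `γ`
(`hσa : σ̃ ∘ (K → K̄) = (K → K̄) ∘ γ`; e.g. Shimura's «element `σ` of `Aut(ℂ)` whose restriction to `K` is the
Frobenius `γ`», lifted to `K̄` by `exists_algEquiv_algebraicClosure_lift_of_isArithFrobAt`).  Although `σ̃ ∉ Gal(K̄/K)`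
in general, conjugation by `σ̃` preserves `Gal(K̄/K)`:

* `absGalConjByAlgEquiv σ̃ γ hσa τ` — the `K`-algebra automorphism `σ̃⁻¹ ∘ τ ∘ σ̃` of `K̄` (`τ ∈ Gal(K̄/K)`);
* `absGalConjBy σ̃ γ hσa : Gal(K̄/K) →* Gal(K̄/K)`, `τ ↦ σ̃⁻¹ τ σ̃` — a group homomorphism, with
  `absGalConjBy_smul : (σ̃⁻¹ τ σ̃) • y = σ̃⁻¹ (τ • σ̃ y)` and `toAlgEquiv_absGalConjBy`;
* `absGalConjBy_symm_comp` — conjugating by `σ̃` and then by `σ̃⁻¹` is the identity; `absGalConjBy_bijective`.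

This is the group-theoretic half of the twisted Galois equivariance `τ • x^σ̃ = (σ̃⁻¹τσ̃ • x)^σ̃` of the transport of
geometric points of an abelian variety to its `γ`-conjugate (Shimura 1998, §18.6, proof of Thm. 18.6, p. 129:
«`(Y^σ)~ = Ỹ^f` for every object `Y` rational over `L`»).  Everything is proved; the two `def`s are genuine.
Cell `hodgecm-mathlib`, E4 programme (F-S5c′), piece Q3 (`GoodReductionAt.TateSpecialisation.conjFrob`), leaf L3a.

## References
* [Shimura1998] G. Shimura, *Abelian Varieties with Complex Multiplication and Modular Functions* (1998), §18.6.
* [NeukirchANT1999] J. Neukirch, *Algebraic Number Theory*, Ch. IV §1 (the absolute Galois group).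
-/

noncomputable section

namespace Literature.NumberTheory.GaloisRepresentations

open Field

variable {K : Type*} [Field K] (σt : AlgebraicClosure K ≃+* AlgebraicClosure K) (γ : K ≃+* K)
  (hσa : ∀ a : K, σt (algebraMap K (AlgebraicClosure K) a) = algebraMap K (AlgebraicClosure K) (γ a))

/-- **`σ̃⁻¹ ∘ τ ∘ σ̃` as a `K`-algebra automorphism of `K̄`**, for `τ ∈ Gal(K̄/K)` and `σ̃` an automorphism of `K̄`
extending `γ ∈ Aut(K)` (`σ̃⁻¹ τ σ̃` fixes `K` because `σ̃|_K = γ`). [cite: NeukirchANT1999, Ch. IV §1] -/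
def absGalConjByAlgEquiv (τ : AlgebraicClosure K ≃ₐ[K] AlgebraicClosure K) :
    AlgebraicClosure K ≃ₐ[K] AlgebraicClosure K :=
  { σt.trans (τ.toRingEquiv.trans σt.symm) with
    commutes' := fun a => by
      change σt.symm (τ (σt (algebraMap K _ a))) = _
      rw [hσa, AlgEquiv.commutes, ← hσa, RingEquiv.symm_apply_apply] }

/-- `absGalConjByAlgEquiv σ̃ γ hσa τ y = σ̃⁻¹ (τ (σ̃ y))`. [cite: NeukirchANT1999, Ch. IV §1] -/
@[simp]
theorem absGalConjByAlgEquiv_apply (τ : AlgebraicClosure K ≃ₐ[K] AlgebraicClosure K) (y : AlgebraicClosure K) :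
    absGalConjByAlgEquiv σt γ hσa τ y = σt.symm (τ (σt y)) :=
  rfl

/-- **Conjugation by `σ̃`: `Gal(K̄/K) →* Gal(K̄/K)`, `τ ↦ σ̃⁻¹ τ σ̃`** (a group homomorphism; Shimura's
`σ⁻¹ Gal σ` bookkeeping in the proof of Thm. 18.6). [cite: Shimura1998, §18.6 proof of Thm. 18.6, p. 129] -/
def absGalConjBy : absoluteGaloisGroup K →* absoluteGaloisGroup K where
  toFun τ := (absoluteGaloisGroup.toAlgEquiv K).symm
    (absGalConjByAlgEquiv σt γ hσa (absoluteGaloisGroup.toAlgEquiv K τ))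
  map_one' := by
    rw [map_one, MulEquiv.map_eq_one_iff]
    apply AlgEquiv.ext; intro y
    rw [absGalConjByAlgEquiv_apply, AlgEquiv.one_apply, RingEquiv.symm_apply_apply, AlgEquiv.one_apply]
  map_mul' τ₁ τ₂ := by
    rw [← map_mul, map_mul]
    congr 1
    apply AlgEquiv.ext; intro y
    rw [absGalConjByAlgEquiv_apply, AlgEquiv.mul_apply, AlgEquiv.mul_apply, absGalConjByAlgEquiv_apply,
      absGalConjByAlgEquiv_apply, RingEquiv.apply_symm_apply]

/-- The underlying `K`-algebra automorphism of `absGalConjBy σ̃ γ hσa τ` is `σ̃⁻¹ ∘ τ ∘ σ̃`. [cite: NeukirchANT1999, Ch. IV §1] -/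
theorem toAlgEquiv_absGalConjBy (τ : absoluteGaloisGroup K) :
    absoluteGaloisGroup.toAlgEquiv K (absGalConjBy σt γ hσa τ) =
      absGalConjByAlgEquiv σt γ hσa (absoluteGaloisGroup.toAlgEquiv K τ) :=
  MulEquiv.apply_symm_apply _ _

/-- **`(σ̃⁻¹ τ σ̃) • y = σ̃⁻¹ (τ • σ̃ y)`** on `K̄`. [cite: Shimura1998, §18.6 proof of Thm. 18.6, p. 129] -/
theorem absGalConjBy_smul (τ : absoluteGaloisGroup K) (y : AlgebraicClosure K) :
    absGalConjBy σt γ hσa τ • y = σt.symm (τ • σt y) := by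
  rw [absoluteGaloisGroup.smul_def, absoluteGaloisGroup.smul_def, toAlgEquiv_absGalConjBy, absGalConjByAlgEquiv_apply]

/-- Equivalently `σ̃ ((σ̃⁻¹ τ σ̃) • y) = τ • σ̃ y`. [cite: NeukirchANT1999, Ch. IV §1] -/
theorem apply_absGalConjBy_smul (τ : absoluteGaloisGroup K) (y : AlgebraicClosure K) :
    σt (absGalConjBy σt γ hσa τ • y) = τ • σt y := by
  rw [absGalConjBy_smul, RingEquiv.apply_symm_apply]

include hσa in
/-- `σ̃⁻¹` extends `γ⁻¹`. [cite: NeukirchANT1999, Ch. IV §1] -/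
theorem symm_algebraMap (a : K) :
    σt.symm (algebraMap K (AlgebraicClosure K) a) = algebraMap K (AlgebraicClosure K) (γ.symm a) := by
  rw [RingEquiv.symm_apply_eq, hσa, RingEquiv.apply_symm_apply]

/-- Conjugating by `σ̃⁻¹` undoes conjugating by `σ̃`. [cite: NeukirchANT1999, Ch. IV §1] -/
theorem absGalConjBy_symm_absGalConjBy (τ : absoluteGaloisGroup K) :
    absGalConjBy σt.symm γ.symm (symm_algebraMap σt γ hσa) (absGalConjBy σt γ hσa τ) = τ := by
  apply (absoluteGaloisGroup.toAlgEquiv K).injective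
  rw [toAlgEquiv_absGalConjBy, toAlgEquiv_absGalConjBy]
  apply AlgEquiv.ext; intro y
  rw [absGalConjByAlgEquiv_apply, absGalConjByAlgEquiv_apply, RingEquiv.symm_symm, RingEquiv.apply_symm_apply,
    RingEquiv.apply_symm_apply]

/-- Conjugating by `σ̃` undoes conjugating by `σ̃⁻¹`. [cite: NeukirchANT1999, Ch. IV §1] -/
theorem absGalConjBy_absGalConjBy_symm (τ : absoluteGaloisGroup K) :
    absGalConjBy σt γ hσa (absGalConjBy σt.symm γ.symm (symm_algebraMap σt γ hσa) τ) = τ := by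
  apply (absoluteGaloisGroup.toAlgEquiv K).injective
  rw [toAlgEquiv_absGalConjBy, toAlgEquiv_absGalConjBy]
  apply AlgEquiv.ext; intro y
  rw [absGalConjByAlgEquiv_apply, absGalConjByAlgEquiv_apply, RingEquiv.symm_symm, RingEquiv.symm_apply_apply,
    RingEquiv.symm_apply_apply]

/-- **Conjugation by `σ̃` is a bijection of `Gal(K̄/K)`** (inverse: conjugation by `σ̃⁻¹`). [cite: NeukirchANT1999, Ch. IV §1] -/
theorem absGalConjBy_bijective : Function.Bijective (absGalConjBy σt γ hσa) :=
  ⟨fun τ₁ τ₂ h => by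
    rw [← absGalConjBy_symm_absGalConjBy σt γ hσa τ₁, h, absGalConjBy_symm_absGalConjBy],
   fun τ => ⟨_, absGalConjBy_absGalConjBy_symm σt γ hσa τ⟩⟩

end Literature.NumberTheory.GaloisRepresentations

end
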